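import Summits.FinalStateConjecture.FinalStateConjecture.Theorems.ZeroEnergyKerrOrBombSymplecticDualOfTheBombDefs
import Literature.Geometry.Lorentzian.StationaryBlackHoleUniquenessProofs
import HarnessLib

/-!
# Route ZeroEnergyKerrOrBomb · crux `StationaryLimitReduction`, line `symplectic-dual-of-the-bomb`:
# stub `stub_probeUniversality` (the Bridge "a scalar bomb is a gravitational bomb") — typing facts

Stub `stub_probeUniversality : Sig.stub_probeUniversality` of the checked skeleton
`Cruxes/StationaryLimitReduction/Lines/symplectic_dual_of_the_bomb.lean` (crux
stmt-FinalStateConjecture-10021, `ZeroEnergyKerrOrBomb.StationaryLimitReduction := KerrOrBomb →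
FinalStateConjecture`) asks: a regular stationary vacuum hole `𝓑` (`InTelescope 𝓑`) read in an adapted
chart `A` covering `𝓗⁺`, which is NOT Killing-mode stable for the scalar wave equation `□_g`
(`¬ ModeStable 𝓑`), carries a growing, horizon-regular, outgoing, non-gauge TENSOR Killing-mode pair of
linearised vacuum gravity (`IsGravitationalModePair 𝓑 A ν ϖ h₁ h₂`, `0 < ν`).

No theorem in print (nor in this tree) produces a growing mode of linearised gravity from a growing
mode of `□_g` on a general stationary vacuum black hole (Teukolsky–Wald spin-weight machinery needs
Petrov type D and relates `s = ±2` to each other, not `s = 0` to `s = 2`; the Ehlers–Geroch / Xanthopoulos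
linearisation produces only `T`-invariant perturbations; Moschidis, arXiv:1608.02041 §1.3: trapping-driven
and fixed-frequency instabilities are logically unrelated). The stub is therefore BLOCKED on an unprinted
theorem; this file records the kernel-checked TYPING FACTS about its two predicates that the line's
composition `StationaryLimitReduction_of` and any future bridge rely on:

* §1 `not_modeStable_iff` — `¬ ModeStable 𝓑` IS the existence of a non-trivial growing scalar
  Killing-mode pair (`StationaryAFBlackHole.IsKillingModePair`, `KillingModeStability.lean`), stated under
  the instance spelling `𝓑.metric.hasLeviCivita` used by `IsGravitationalModePair` while `ModeStable` is
  defined under `𝓑.metric.toPseudoRiemannianMetric.hasLeviCivita`: the proof term is the Literature lemma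
  itself, so the two `haveI`s denote one and the same instance term (no typing seam between the
  hypothesis and the conclusion of the stub);
* §2 anti-junk for the conclusion: a pair which is pure gauge on the d.o.c. with d.o.c.-smooth
  potentials is never a gravitational mode pair (`not_isGravitationalModePair_of_gauge`; a fortiori with
  horizon-regular potentials, `not_isGravitationalModePair_of_gauge_nhds` — the sibling line
  `one-locked-explosion` asks smoothness of the potential on an open set `⊇ d.o.c. ∪ 𝓗⁺`, so the present
  line's non-gauge clause is the STRONGER exclusion); hence a gravitational mode pair is non-zero
  somewhere on the d.o.c. (`exists_ne_zero_of_isGravitationalModePair`, potentials `ξ = 0`,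
  `lieDerivBilin_zero_left`, smoothness of the zero section), the zero pair is excluded
  (`not_isGravitationalModePair_zero`, although `DRic(0) = 0` and `𝓛_T 0 = 0` hold), and a `T`-STATIONARY
  pair (`𝓛_T hᵢ = 0` on the d.o.c., e.g. a linearised change of Kerr parameters) can only be a mode pair
  of frequency `0` (`rate_eq_zero_of_isGravitationalModePair_of_stationary`), so it never meets the stub's
  `0 < ν`; and the OUTGOING (boundedness) clause is never vacuous: its region
  `d.o.c. ∩ I⁻(embed Σ_ext')` is charted by `A` and meets every Killing orbit of the d.o.c.
  (`exists_orbit_mem_outgoingRegion`, `outgoingRegion_nonempty`; Chruściel–Costa 2008 §4.2 via the tree's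
  `exists_stationary_flow`, `exists_apply_mem_chronologicalPast_image_far_of_mem_doc`);
* §3 `probeUniversality_iff_bridge` — the registered statement, verbatim, is EQUIVALENT to the
  scalar-to-tensor bridge "`InTelescope 𝓑 → 𝓗⁺ ⊆ range A → ∀ non-trivial scalar Killing-mode pair of
  rate `ν > 0` → ∃ gravitational mode pair of some rate `ν' > 0`", the exact shape of the missing theorem;
  and `probeUniversality_of_forall_modeStable` — it is implied by "telescope holes charted across `𝓗⁺` are
  Killing-mode stable" (smooth black-hole uniqueness + Whiting: the stub is conjecturally VACUOUS).

No named facts; Mathlib + `KillingModeStability.lean`, `LinearizedRicci.lean`,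
`StationaryBlackHoleUniquenessProofs.lean` (the stationary flow and the orbit lemma of Chruściel–Costa
§4.2, all proved) only.
-/

-- every `Summit.FinalStateConjecture.FinalStateConjecture.…` name repeats the summit = sub-problem segment (D-0017 layout)
set_option linter.dupNamespace false

noncomputable section

open scoped Manifold ContDiff Topology
open Set Bundle Literature.Geometry.Lorentzian

namespace Summit.FinalStateConjecture.FinalStateConjecture.Theorems.SymplecticDualOfTheBomb

open Summit.FinalStateConjecture.FinalStateConjecture.Theorems.OneLockedExplosion

/-! ## §1 `¬ ModeStable` is a non-trivial growing scalar Killing-mode pair (one instance term) -/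

/-- The two instance spellings `𝓑.metric.hasLeviCivita` (used by `IsGravitationalModePair`) and
`𝓑.metric.toPseudoRiemannianMetric.hasLeviCivita` (used by `ModeStable`, `InTelescope`) elaborate to
the same term (and `HasLeviCivita` is a `Prop`). [folklore] -/
example (𝓑 : StationaryAFBlackHole.{0}) :
    (𝓑.metric.hasLeviCivita : 𝓑.metric.HasLeviCivita) =
      𝓑.metric.toPseudoRiemannianMetric.hasLeviCivita :=
  rfl

/-- **`¬ ModeStable 𝓑` unbundled**: the hole is not Killing-mode stable for `□_g` iff it carries a
scalar Killing-mode pair `(ψ, χ)` of some frequency `ν + iω` with `ν > 0` — smooth on an open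
neighbourhood of `d.o.c. ∪ 𝓗⁺`, `□_g ψ = □_g χ = 0` and `Tψ = νψ − ωχ`, `Tχ = ωψ + νχ` on the d.o.c.,
bounded on `d.o.c. ∩ I⁻(embed (Σ_ext'))` — which does not vanish identically on the d.o.c.
(`StationaryAFBlackHole.not_isKillingModeStable_iff_exists_isKillingModePair`, read across the two
instance spellings of the line's vocabulary, which are one term). [folklore] -/
theorem not_modeStable_iff : ∀ (𝓑 : StationaryAFBlackHole.{0}), ¬ ModeStable 𝓑 ↔ haveI : 𝓑.metric.HasLeviCivita := 𝓑.metric.hasLeviCivita; ∃ (ν ϖ : ℝ) (ψ χ : 𝓑.carrier → ℝ), 0 < ν ∧ 𝓑.IsKillingModePair ν ϖ ψ χ ∧ ∃ x ∈ 𝓑.doc, ψ x ≠ 0 ∨ χ x ≠ 0 :=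
  fun 𝓑 ↦
    haveI : 𝓑.metric.HasLeviCivita := 𝓑.metric.hasLeviCivita
    𝓑.not_isKillingModeStable_iff_exists_isKillingModePair

/-! ## §2 Anti-junk: what the gauge clause of `IsGravitationalModePair` excludes -/

/-- **Pure gauge on the d.o.c. is excluded**: if `hᵢ = 𝓛_{ξᵢ} g` on the d.o.c. for vector fields
`ξ₁, ξ₂` smooth on the d.o.c. (as sections of the tangent bundle), then `(h₁, h₂)` is not a
gravitational mode pair of any rate in any chart — the last clause of the definition, as the usable
lemma (Wald 1984, (C.2.15)–(C.2.17): `𝓛_ξ g` is the gauge freedom of linearised gravity). [cite: Wald1984GR, Appendix C.2, (C.2.15)–(C.2.17)] -/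
theorem not_isGravitationalModePair_of_gauge : ∀ (𝓑 : StationaryAFBlackHole.{0}) (A : 𝓑.AdaptedChart) (ν ϖ : ℝ) (h₁ h₂ : HoleBilinField 𝓑) (ξ₁ ξ₂ : (p : 𝓑.carrier) → TangentSpace (𝓡 4) p), ContMDiffOn (𝓡 4) ((𝓡 4).prod 𝓘(ℝ, E4)) ∞ (fun p ↦ (TotalSpace.mk' E4 p (ξ₁ p) : TangentBundle (𝓡 4) 𝓑.carrier)) 𝓑.doc → ContMDiffOn (𝓡 4) ((𝓡 4).prod 𝓘(ℝ, E4)) ∞ (fun p ↦ (TotalSpace.mk' E4 p (ξ₂ p) : TangentBundle (𝓡 4) 𝓑.carrier)) 𝓑.doc → (haveI : 𝓑.metric.HasLeviCivita := 𝓑.metric.hasLeviCivita; ∀ p ∈ 𝓑.doc, h₁ p = 𝓑.metric.toPseudoRiemannianMetric.lieDerivBilin ξ₁ 𝓑.metric.val p ∧ h₂ p = 𝓑.metric.toPseudoRiemannianMetric.lieDerivBilin ξ₂ 𝓑.metric.val p) → ¬ IsGravitationalModePair 𝓑 A ν ϖ h₁ h₂ :=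
  fun _ _ _ _ _ _ ξ₁ ξ₂ hξ₁ hξ₂ hg hmode ↦ hmode.2.2.2.2.2 ⟨ξ₁, ξ₂, hξ₁, hξ₂, hg⟩

/-- **Horizon-regular gauge is excluded a fortiori** (comparison with the sibling line's
`OneLockedExplosion.IsPureGaugeOnDoc`, whose potential is smooth on an open `U ⊇ d.o.c. ∪ 𝓗⁺`):
potentials smooth on such a `U` are smooth on the d.o.c. (`ContMDiffOn.mono`), so a pair which is
pure gauge on the d.o.c. with HORIZON-REGULAR potentials is not a gravitational mode pair either —
the present line's non-gauge clause (potentials smooth on the d.o.c. only) is the STRONGER exclusion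
of the two conventions. [cite: Wald1984GR, Appendix C.2, (C.2.15)–(C.2.17)] -/
theorem not_isGravitationalModePair_of_gauge_nhds : ∀ (𝓑 : StationaryAFBlackHole.{0}) (A : 𝓑.AdaptedChart) (ν ϖ : ℝ) (h₁ h₂ : HoleBilinField 𝓑) (U : Set 𝓑.carrier) (ξ₁ ξ₂ : (p : 𝓑.carrier) → TangentSpace (𝓡 4) p), 𝓑.doc ∪ 𝓑.horizon ⊆ U → ContMDiffOn (𝓡 4) ((𝓡 4).prod 𝓘(ℝ, E4)) ∞ (fun p ↦ (TotalSpace.mk' E4 p (ξ₁ p) : TangentBundle (𝓡 4) 𝓑.carrier)) U → ContMDiffOn (𝓡 4) ((𝓡 4).prod 𝓘(ℝ, E4)) ∞ (fun p ↦ (TotalSpace.mk' E4 p (ξ₂ p) : TangentBundle (𝓡 4) 𝓑.carrier)) U → (haveI : 𝓑.metric.HasLeviCivita := 𝓑.metric.hasLeviCivita; ∀ p ∈ 𝓑.doc, h₁ p = 𝓑.metric.toPseudoRiemannianMetric.lieDerivBilin ξ₁ 𝓑.metric.val p ∧ h₂ p = 𝓑.metric.toPseudoRiemannianMetric.lieDerivBilin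 ξ₂ 𝓑.metric.val p) → ¬ IsGravitationalModePair 𝓑 A ν ϖ h₁ h₂ :=
  fun 𝓑 A ν ϖ h₁ h₂ _ ξ₁ ξ₂ hU hξ₁ hξ₂ hg ↦
    not_isGravitationalModePair_of_gauge 𝓑 A ν ϖ h₁ h₂ ξ₁ ξ₂ (hξ₁.mono (subset_union_left.trans hU))
      (hξ₂.mono (subset_union_left.trans hU)) hg

/-- **A gravitational mode pair does not vanish identically on the d.o.c.** (the tensor analogue of
the non-triviality clause `∃ x ∈ d.o.c., ψ x ≠ 0 ∨ χ x ≠ 0` of the scalar bomb): otherwise it is pure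
gauge there with the potentials `ξ₁ = ξ₂ = 0`, which are smooth (zero section of `TM`,
`Bundle.contMDiff_zeroSection`) and have `𝓛_0 g = 0` (`lieDerivBilin_zero_left`). [folklore] -/
theorem exists_ne_zero_of_isGravitationalModePair : ∀ {𝓑 : StationaryAFBlackHole.{0}} {A : 𝓑.AdaptedChart} {ν ϖ : ℝ} {h₁ h₂ : HoleBilinField 𝓑}, IsGravitationalModePair 𝓑 A ν ϖ h₁ h₂ → ∃ p ∈ 𝓑.doc, h₁ p ≠ 0 ∨ h₂ p ≠ 0 := by
  intro 𝓑 A ν ϖ h₁ h₂ hmode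
  by_contra hzero
  push Not at hzero
  haveI : 𝓑.metric.HasLeviCivita := 𝓑.metric.hasLeviCivita
  have h0 : ContMDiffOn (𝓡 4) ((𝓡 4).prod 𝓘(ℝ, E4)) ∞
      (fun p ↦ (TotalSpace.mk' E4 p ((0 : (p : 𝓑.carrier) → TangentSpace (𝓡 4) p) p) :
        TangentBundle (𝓡 4) 𝓑.carrier)) 𝓑.doc :=
    (Bundle.contMDiff_zeroSection ℝ (TangentSpace (𝓡 4) : 𝓑.carrier → Type _)).contMDiffOn
  refine hmode.2.2.2.2.2 ⟨0, 0, h0, h0, fun p hp ↦ ?_⟩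
  rw [PseudoRiemannianMetric.lieDerivBilin_zero_left]
  exact hzero p hp

/-- **The zero pair is not a gravitational mode pair** of any rate in any chart — although it is
symmetric, smooth, solves `DRic_g(0) = 0` (`linearizedRicci_zero`), satisfies both Killing
eigen-equations (`𝓛_T 0 = 0 = ν • 0 − ϖ • 0`) and is bounded: the gauge clause is what excludes it.
So the conclusion of `stub_probeUniversality` is not junk-satisfiable by `h₁ = h₂ = 0`, exactly as
its hypothesis `¬ ModeStable 𝓑` is not (`isKillingModePair_zero` + the non-vanishing clause). [folklore] -/
theorem not_isGravitationalModePair_zero : ∀ (𝓑 : StationaryAFBlackHole.{0}) (A : 𝓑.AdaptedChart) (ν ϖ : ℝ), ¬ IsGravitationalModePair 𝓑 A ν ϖ (fun _ ↦ 0) (fun _ ↦ 0) := by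
  intro 𝓑 A ν ϖ hmode
  obtain ⟨p, -, hp⟩ := exists_ne_zero_of_isGravitationalModePair hmode
  simp at hp

/-- **Stationary perturbations are not growing modes.** If a gravitational mode pair of rate
`ν + iϖ` is `T`-invariant on the d.o.c. (`𝓛_T h₁ = 𝓛_T h₂ = 0` there — e.g. a linearised change of
the parameters of a stationary family through `g`, which solves `DRic = 0` and is not pure gauge),
then `ν = ϖ = 0`: the eigen-equations give `ν h₁ = ϖ h₂`, `ν h₂ = −ϖ h₁`, whence
`(ν² + ϖ²) hᵢ = 0` on the d.o.c., while some `hᵢ p ≠ 0` there (`exists_ne_zero_of_isGravitationalModePair`). In particular such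
a pair never witnesses the conclusion `0 < ν` of `stub_probeUniversality`. [folklore] -/
theorem rate_eq_zero_of_isGravitationalModePair_of_stationary : ∀ {𝓑 : StationaryAFBlackHole.{0}} {A : 𝓑.AdaptedChart} {ν ϖ : ℝ} {h₁ h₂ : HoleBilinField 𝓑}, IsGravitationalModePair 𝓑 A ν ϖ h₁ h₂ → (haveI : 𝓑.metric.HasLeviCivita := 𝓑.metric.hasLeviCivita; ∀ p ∈ 𝓑.doc, 𝓑.metric.toPseudoRiemannianMetric.lieDerivBilin 𝓑.killing h₁ p = 0 ∧ 𝓑.metric.toPseudoRiemannianMetric.lieDerivBilin 𝓑.killing h₂ p = 0) → ν = 0 ∧ ϖ = 0 := by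
  intro 𝓑 A ν ϖ h₁ h₂ hmode hstat
  haveI : 𝓑.metric.HasLeviCivita := 𝓑.metric.hasLeviCivita
  by_contra hne
  have hsq : ν * ν + ϖ * ϖ ≠ 0 := by
    intro h0
    refine hne ⟨?_, ?_⟩ <;> nlinarith [mul_self_nonneg ν, mul_self_nonneg ϖ]
  obtain ⟨p, hp, hp0⟩ := exists_ne_zero_of_isGravitationalModePair hmode
  obtain ⟨e₁, e₂⟩ := hmode.2.2.2.1 p hp
  rw [(hstat p hp).1] at e₁
  rw [(hstat p hp).2] at e₂
  -- `e₁ : 0 = ν • h₁ p - ϖ • h₂ p`, `e₂ : 0 = ϖ • h₁ p + ν • h₂ p`; read them on vectors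
  have key : ∀ v w : TangentSpace (𝓡 4) p, h₁ p v w = 0 ∧ h₂ p v w = 0 := by
    intro v w
    have f₁ : (0 : ℝ) = ν * h₁ p v w - ϖ * h₂ p v w :=
      congrArg (fun B : TangentSpace (𝓡 4) p →L[ℝ] TangentSpace (𝓡 4) p →L[ℝ] ℝ ↦ B v w) e₁
    have f₂ : (0 : ℝ) = ϖ * h₁ p v w + ν * h₂ p v w :=
      congrArg (fun B : TangentSpace (𝓡 4) p →L[ℝ] TangentSpace (𝓡 4) p →L[ℝ] ℝ ↦ B v w) e₂
    refine ⟨(mul_eq_zero.mp ?_).resolve_left hsq, (mul_eq_zero.mp ?_).resolve_left hsq⟩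
    · linear_combination -(ν * f₁ + ϖ * f₂)
    · linear_combination ϖ * f₁ - ν * f₂
  refine hp0.elim (fun h ↦ h ?_) (fun h ↦ h ?_)
  · ext v w
    exact (key v w).1
  · ext v w
    exact (key v w).2

/-- **The outgoing region of `IsGravitationalModePair` meets every Killing orbit of the d.o.c.,
inside the chart.** The boundedness clause constrains the chart components of `hᵢ` only at chart
points over `d.o.c. ∩ I⁻(embed (Σ_ext'))`; this set is not small: for every `q` in the d.o.c. the
`T`-orbit `γ` through `q` (an integral curve of the complete Killing field, `exists_stationary_flow`)
reaches a point `γ t` of that region (Chruściel–Costa 2008, §4.2, first step of the proof of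
Thm. 4.5: `exists_apply_mem_chronologicalPast_image_far_of_mem_doc`; the orbit stays in the d.o.c.,
`mem_doc_of_isMIntegralCurve`), and that point is charted by `A` (`AdaptedChart.doc_subset_range`).
With the eigen-equations (which transport `(h₁, h₂)` along `γ` by `e^{νt}` times a rotation) the
clause therefore controls the pair on the whole d.o.c.; in particular the region is non-empty
(`doc_nonempty`). [cite: ChruscielCosta2008, §4.2 (proof of Thm. 4.5)] -/
theorem exists_orbit_mem_outgoingRegion : ∀ (𝓑 : StationaryAFBlackHole.{0}) (A : 𝓑.AdaptedChart), ∀ q ∈ 𝓑.doc, ∃ (γ : ℝ → 𝓑.carrier) (t : ℝ) (x : A.domain), IsMIntegralCurve γ 𝓑.killing ∧ γ 0 = q ∧ A.toFun x = γ t ∧ A.toFun x ∈ 𝓑.doc ∩ 𝓑.metric.chronologicalPast 𝓑.timeOrientation (𝓑.embed '' 𝓑.e.far (𝓑.e.R + 1)) := by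
  intro 𝓑 A q hq
  haveI : 𝓑.metric.HasLeviCivita := 𝓑.metric.hasLeviCivita
  obtain ⟨θ, -, hθ0, -, hθX, -⟩ := 𝓑.exists_stationary_flow
  obtain ⟨t, ht⟩ :=
    StationaryAFBlackHole.exists_apply_mem_chronologicalPast_image_far_of_mem_doc hq (hθX q) (hθ0 q)
  have hdoc : θ (t, q) ∈ 𝓑.doc :=
    StationaryAFBlackHole.mem_doc_of_isMIntegralCurve (hθX q) ((hθ0 q).symm ▸ hq) t
  obtain ⟨x, hx⟩ := A.doc_subset_range hdoc
  exact ⟨fun s ↦ θ (s, q), t, x, hθX q, hθ0 q, hx, hx ▸ ⟨hdoc, ht⟩⟩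

/-- The outgoing region of `IsGravitationalModePair` is charted and non-empty (so its boundedness
clause is never vacuous): some chart point of `A` lies over `d.o.c. ∩ I⁻(embed (Σ_ext'))`
(`doc_nonempty` and `exists_orbit_mem_outgoingRegion`). [cite: ChruscielCosta2008, §2.2 (2.2)] -/
theorem outgoingRegion_nonempty : ∀ (𝓑 : StationaryAFBlackHole.{0}) (A : 𝓑.AdaptedChart), ∃ x : A.domain, A.toFun x ∈ 𝓑.doc ∩ 𝓑.metric.chronologicalPast 𝓑.timeOrientation (𝓑.embed '' 𝓑.e.far (𝓑.e.R + 1)) := by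
  intro 𝓑 A
  haveI : 𝓑.metric.HasLeviCivita := 𝓑.metric.hasLeviCivita
  obtain ⟨q, hq⟩ := 𝓑.doc_nonempty
  obtain ⟨-, -, x, -, -, -, hx⟩ := exists_orbit_mem_outgoingRegion 𝓑 A q hq
  exact ⟨x, hx⟩

/-! ## §3 The registered statement in bridge form -/

/-- **`Sig.stub_probeUniversality` is exactly the scalar-to-tensor Killing-mode bridge.** The
registered statement (left, verbatim the body of `Sig.stub_probeUniversality`) is equivalent to: for
every regular hole `𝓑` charted across `𝓗⁺` by `A`, every scalar Killing-mode pair `(ψ, χ)` of `□_g`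
of rate `ν > 0` (`IsKillingModePair`: smooth near `d.o.c. ∪ 𝓗⁺`, wave + eigen-equations on the
d.o.c., bounded on `d.o.c. ∩ I⁻(embed Σ_ext')`) which is non-zero somewhere on the d.o.c. yields a
gravitational mode pair `(h₁, h₂)` of SOME rate `ν' > 0` (`not_modeStable_iff`). This is the theorem
that is missing in print and in the tree (no scalar `□_g`-mode to linearised-gravity-mode transfer on
a general stationary vacuum black hole). [cite: ShlapentokhRothman2015ModeStability, §1.3 and Thm. 1.5] -/
theorem probeUniversality_iff_bridge : (∀ (𝓑 : StationaryAFBlackHole.{0}) (A : 𝓑.AdaptedChart), InTelescope 𝓑 → 𝓑.horizon ⊆ Set.range A.toFun → ¬ ModeStable 𝓑 → ∃ (ν ϖ : ℝ) (h₁ h₂ : HoleBilinField 𝓑), 0 < ν ∧ IsGravitationalModePair 𝓑 A ν ϖ h₁ h₂) ↔ ∀ (𝓑 : StationaryAFBlackHole.{0}) (A : 𝓑.AdaptedChart), InTelescope 𝓑 → 𝓑.horizon ⊆ Set.range A.toFun → haveI : 𝓑.metric.HasLeviCivita := 𝓑.metric.hasLeviCivita; ∀ (ν ϖ : ℝ)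 (ψ χ : 𝓑.carrier → ℝ), 0 < ν → 𝓑.IsKillingModePair ν ϖ ψ χ → ∀ x ∈ 𝓑.doc, (ψ x ≠ 0 ∨ χ x ≠ 0) → ∃ (ν' ϖ' : ℝ) (h₁ h₂ : HoleBilinField 𝓑), 0 < ν' ∧ IsGravitationalModePair 𝓑 A ν' ϖ' h₁ h₂ := by
  constructor
  · intro h 𝓑 A hreg hhor ν ϖ ψ χ hν hpair x hx hx0
    exact h 𝓑 A hreg hhor ((not_modeStable_iff 𝓑).2 ⟨ν, ϖ, ψ, χ, hν, hpair, x, hx, hx0⟩)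
  · intro h 𝓑 A hreg hhor hms
    obtain ⟨ν, ϖ, ψ, χ, hν, hpair, x, hx, hx0⟩ := (not_modeStable_iff 𝓑).1 hms
    exact h 𝓑 A hreg hhor ν ϖ ψ χ hν hpair x hx hx0

/-- **The registered statement is implied by "telescope holes charted across `𝓗⁺` are Killing-mode
stable"** (the `Γ₀` direction: under SMOOTH black-hole uniqueness — the Alexakis–Ionescu–Klainerman
schema `AlexakisIonescuKlainermanRigidity` at a telescope predicate, an open problem — every such hole
is a Kerr exterior and Whiting's mode stability makes it `ModeStable`, so the Bridge's hypothesis is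
never met). Recorded so that the lead can see the stub is conjecturally VACUOUS as well as
conjecturally true; classical logic only. [folklore] -/
theorem probeUniversality_of_forall_modeStable : (∀ (𝓑 : StationaryAFBlackHole.{0}) (A : 𝓑.AdaptedChart), InTelescope 𝓑 → 𝓑.horizon ⊆ Set.range A.toFun → ModeStable 𝓑) → ∀ (𝓑 : StationaryAFBlackHole.{0}) (A : 𝓑.AdaptedChart), InTelescope 𝓑 → 𝓑.horizon ⊆ Set.range A.toFun → ¬ ModeStable 𝓑 → ∃ (ν ϖ : ℝ) (h₁ h₂ : HoleBilinField 𝓑), 0 < ν ∧ IsGravitationalModePair 𝓑 A ν ϖ h₁ h₂ :=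
  fun h 𝓑 A hreg hhor hms ↦ (hms (h 𝓑 A hreg hhor)).elim

end Summit.FinalStateConjecture.FinalStateConjecture.Theorems.SymplecticDualOfTheBomb

end
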